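import Summits.NavierStokesRegularity.NavierStokesRegularity.Theorems.PerpetualPumpThesisTameDuhamelBoundSums

/-!
# Stub `tameDuhamelBound` for `PerpetualPump.Thesis`, part VI: the tame paraproduct estimate for
# Tao's Euler form

Support file (part 6 of the stub `tameDuhamelBound` of line `SketchIdeator2`, crux
stmt-NavierStokesRegularity-1832). The pieces are reassembled: with
`s_N = ∑_{|j| ≤ N} φ_j = 1 - r_N` (`r_N → 0` off the origin, `|r_N| ≤ 3`, tree `remainderSymbol`),
`∑_{|j|,|k| ≤ N} ⟨B(P_jF, P_kG), H⟩ = -πi ∫∫ s_N(ξ₁) s_N(ξ₂) Λ(F̂(ξ₁), Ĝ(ξ₂), Ĥ(ξ₃))` tends to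
`⟨B(F,G), H⟩` by dominated convergence (the integrand of Tao's (1.3) is absolutely integrable for
`F, G ∈ H¹⁰`, `H ∈ L²`, tree `integrable_Λ_fourierFn`), and the double-sum bound of part V passes to
the limit. The result is the **tame trilinear estimate**

  `|⟨B(F,G), H⟩| ≤ K (‖F‖_{Ḃ⁰_{∞,1}} ‖G‖_{H¹⁰} + ‖F‖_{H¹⁰} ‖G‖_{Ḃ⁰_{∞,1}}) ‖H‖_{H⁻⁹}`

(`FB.enorm_eulerForm_le_tame`) for divergence-free `F, G ∈ H¹⁰` and `H ∈ L²(ℝ³; ℂ³)` — the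
Moser / Kato–Ponce-type product estimate `‖F ⊗ G‖_{H¹⁰} ≲ ‖F‖_∞‖G‖_{H¹⁰} + ‖F‖_{H¹⁰}‖G‖_∞` in the
`Ḃ⁰_{∞,1}` currency of line `SketchIdeator2`, with one derivative moved onto `H`.

## References

* H. Bahouri, J.-Y. Chemin, R. Danchin, *Fourier Analysis and Nonlinear PDE* (2011), §2.6,
  Cor. 2.86 (tame estimates).
* T. Tao, J. Amer. Math. Soc. 29 (2016), 601–674, §1.1 (1.3)–(1.4), (1.14).
-/

noncomputable section

open MeasureTheory Filter Topology FourierTransform Real Complex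
open scoped SchwartzMap ENNReal NNReal FourierTransform

set_option linter.dupNamespace false

namespace Summit.NavierStokesRegularity.NavierStokesRegularity.Theorems.PerpetualPumpThesis.FB

open Literature.Analysis.FunctionSpaces Literature.Analysis.FluidPDE
  Literature.Analysis.FluidPDE.Tao2016

/-! ### The partial sums of the dyadic partition -/

/-- **Telescoping the symbols**: `∑_{j=-N}^{N} φ_j(ξ) = χ(2^{-N}ξ) - χ(2^{N+1}ξ) = 1 - r_N(ξ)`. -/
theorem sum_Icc_dyadicSymbol (N : ℕ) (ξ : EuclideanSpace ℝ (Fin 3)) :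
    ∑ j ∈ Finset.Icc (-(N : ℤ)) N, dyadicSymbol j ξ = 1 - remainderSymbol N ξ := by
  -- adapted from `sum_Icc_lpBlock_eq` (LittlewoodPaleyConvergenceProofs), at the level of symbols
  have hblock : ∀ j : ℤ, dyadicSymbol j ξ = lowFreqSymbol j ξ - lowFreqSymbol (j - 1) ξ := fun j => by
    have h := congr_fun (dyadicSymbol_eq_sub (E := EuclideanSpace ℝ (Fin 3)) j) ξ
    simpa using h
  have htel : ∀ n : ℕ, ∑ j ∈ Finset.Icc (-(n : ℤ)) n, dyadicSymbol j ξ =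
      lowFreqSymbol n ξ - lowFreqSymbol (-(n : ℤ) - 1) ξ := by
    intro n
    induction n with
    | zero =>
        simp only [Nat.cast_zero, neg_zero, Finset.Icc_self, Finset.sum_singleton, zero_sub]
        exact hblock 0
    | succ n ih =>
        have hset : Finset.Icc (-((n + 1 : ℕ) : ℤ)) ((n + 1 : ℕ) : ℤ) =
            insert ((n : ℤ) + 1) (insert (-(n : ℤ) - 1) (Finset.Icc (-(n : ℤ)) n)) := by
          ext j
          simp only [Finset.mem_Icc, Finset.mem_insert, Nat.cast_add, Nat.cast_one]
          omega
        have h1 : (n : ℤ) + 1 ∉ insert (-(n : ℤ) - 1) (Finset.Icc (-(n : ℤ)) n) := by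
          simp only [Finset.mem_insert, Finset.mem_Icc]
          omega
        have h2 : -(n : ℤ) - 1 ∉ Finset.Icc (-(n : ℤ)) (n : ℤ) := by
          simp only [Finset.mem_Icc]
          omega
        rw [hset, Finset.sum_insert h1, Finset.sum_insert h2, ih, hblock, hblock]
        simp only [Nat.cast_add, Nat.cast_one]
        rw [show (n : ℤ) + 1 - 1 = n by ring, show -((n : ℤ) + 1) - 1 = -(n : ℤ) - 1 - 1 by ring]
        abel
  rw [htel N, remainderSymbol]
  ring

/-- The partial sums are bounded by `4`. -/
theorem norm_sum_Icc_dyadicSymbol_le (N : ℕ) (ξ : EuclideanSpace ℝ (Fin 3)) :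
    ‖∑ j ∈ Finset.Icc (-(N : ℤ)) N, dyadicSymbol j ξ‖ ≤ 4 := by
  rw [sum_Icc_dyadicSymbol]
  calc ‖(1 : ℂ) - remainderSymbol N ξ‖ ≤ ‖(1 : ℂ)‖ + ‖remainderSymbol N ξ‖ := norm_sub_le _ _
    _ ≤ 1 + 3 := add_le_add (by simp) (norm_remainderSymbol_le N ξ)
    _ = 4 := by norm_num

/-- The partial sums tend to `1` off the origin. -/
theorem tendsto_sum_Icc_dyadicSymbol {ξ : EuclideanSpace ℝ (Fin 3)} (hξ : ξ ≠ 0) :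
    Tendsto (fun N : ℕ => ∑ j ∈ Finset.Icc (-(N : ℤ)) N, dyadicSymbol j ξ) atTop (𝓝 1) := by
  simp_rw [sum_Icc_dyadicSymbol]
  simpa using (tendsto_const_nhds (x := (1 : ℂ))).sub (tendsto_remainderSymbol hξ)

/-- The partial sums are continuous. -/
theorem continuous_sum_Icc_dyadicSymbol (N : ℕ) :
    Continuous fun ξ : EuclideanSpace ℝ (Fin 3) => ∑ j ∈ Finset.Icc (-(N : ℤ)) N, dyadicSymbol j ξ :=
  continuous_finsetSum _ fun j _ => (contDiff_dyadicSymbol j).continuous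

/-! ### The pieces as weighted Fourier integrals -/

/-- **A piece as a weighted Fourier integral**:
`⟨B(P_jF, P_kG), H⟩ = -πi ∫∫ φ_j(ξ₁) φ_k(ξ₂) Λ(F̂(ξ₁), Ĝ(ξ₂), Ĥ(ξ₃))`. -/
theorem eulerForm_pieces_eq (F G H : L2C) (j k : ℤ) :
    eulerForm (fourierMultiplier ((memLp_top_dyadicSymbol (E := EuclideanSpace ℝ (Fin 3)) j).toLp _) F)
        (fourierMultiplier ((memLp_top_dyadicSymbol (E := EuclideanSpace ℝ (Fin 3)) k).toLp _) G) H =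
      -(↑π * I) * ∫ p : EuclideanSpace ℝ (Fin 3) × EuclideanSpace ℝ (Fin 3),
        dyadicSymbol j p.1 * dyadicSymbol k p.2 *
          Λ p.1 p.2 (fourierFn F p.1) (fourierFn G p.2) (fourierFn H (-p.1 - p.2)) := by
  unfold eulerForm
  congr 1
  refine integral_congr_ae ?_
  rw [Measure.volume_eq_prod]
  have h1 := (Measure.quasiMeasurePreserving_fst (μ := (volume : Measure (EuclideanSpace ℝ (Fin 3))))
    (ν := (volume : Measure (EuclideanSpace ℝ (Fin 3))))).ae_eq (fourierFn_blockPiece j F)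
  have h2 := (Measure.quasiMeasurePreserving_snd (μ := (volume : Measure (EuclideanSpace ℝ (Fin 3))))
    (ν := (volume : Measure (EuclideanSpace ℝ (Fin 3))))).ae_eq (fourierFn_blockPiece k G)
  filter_upwards [h1, h2] with p hp1 hp2
  simp only [Function.comp_apply] at hp1 hp2
  rw [hp1, hp2]
  simp only [Λ, cdot, PiLp.smul_apply, smul_eq_mul, Fin.sum_univ_three]
  ring

/-- Each weighted integrand `φ_j(ξ₁) φ_k(ξ₂) Λ(F̂, Ĝ, Ĥ)` is integrable for `F, G ∈ H¹⁰`, `H ∈ L²`. -/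
theorem integrable_pieces_integrand {F G : L2C} (H : L2C) (hF10 : eFourierSobolevNorm 10 F < ⊤)
    (hG10 : eFourierSobolevNorm 10 G < ⊤) (j k : ℤ) :
    Integrable (fun p : EuclideanSpace ℝ (Fin 3) × EuclideanSpace ℝ (Fin 3) =>
      dyadicSymbol j p.1 * dyadicSymbol k p.2 *
        Λ p.1 p.2 (fourierFn F p.1) (fourierFn G p.2) (fourierFn H (-p.1 - p.2))) := by
  have hΦ := integrable_Λ_fourierFn H hF10 hG10
  refine hΦ.bdd_mul (c := 2 * 2) ?_ (ae_of_all _ fun p => ?_)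
  · exact (((contDiff_dyadicSymbol j).continuous.comp continuous_fst).mul
      ((contDiff_dyadicSymbol k).continuous.comp continuous_snd)).aestronglyMeasurable
  · rw [norm_mul]
    exact mul_le_mul (norm_dyadicSymbol_le_two j _) (norm_dyadicSymbol_le_two k _) (norm_nonneg _)
      zero_le_two

/-- **The partial double sums of the pieces**:
`∑_{|j|,|k| ≤ N} ⟨B(P_jF, P_kG), H⟩ = -πi ∫∫ s_N(ξ₁) s_N(ξ₂) Λ(F̂(ξ₁), Ĝ(ξ₂), Ĥ(ξ₃))`. -/
theorem sum_sum_eulerForm_pieces_eq {F G : L2C} (H : L2C) (hF10 : eFourierSobolevNorm 10 F < ⊤)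
    (hG10 : eFourierSobolevNorm 10 G < ⊤) (N : ℕ) :
    ∑ j ∈ Finset.Icc (-(N : ℤ)) N, ∑ k ∈ Finset.Icc (-(N : ℤ)) N,
        eulerForm (fourierMultiplier ((memLp_top_dyadicSymbol (E := EuclideanSpace ℝ (Fin 3)) j).toLp _) F)
          (fourierMultiplier ((memLp_top_dyadicSymbol (E := EuclideanSpace ℝ (Fin 3)) k).toLp _) G) H =
      -(↑π * I) * ∫ p : EuclideanSpace ℝ (Fin 3) × EuclideanSpace ℝ (Fin 3),
        (∑ j ∈ Finset.Icc (-(N : ℤ)) N, dyadicSymbol j p.1) *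
          (∑ k ∈ Finset.Icc (-(N : ℤ)) N, dyadicSymbol k p.2) *
          Λ p.1 p.2 (fourierFn F p.1) (fourierFn G p.2) (fourierFn H (-p.1 - p.2)) := by
  have hI := fun j k => integrable_pieces_integrand H hF10 hG10 j k
  simp_rw [eulerForm_pieces_eq, ← Finset.mul_sum]
  congr 1
  have hpt : ∀ p : EuclideanSpace ℝ (Fin 3) × EuclideanSpace ℝ (Fin 3),
      (∑ j ∈ Finset.Icc (-(N : ℤ)) N, dyadicSymbol j p.1) * (∑ k ∈ Finset.Icc (-(N : ℤ)) N, dyadicSymbol k p.2) * Λ p.1 p.2 (fourierFn F p.1) (fourierFn G p.2) (fourierFn H (-p.1 - p.2)) =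
        ∑ j ∈ Finset.Icc (-(N : ℤ)) N, ∑ k ∈ Finset.Icc (-(N : ℤ)) N,
          dyadicSymbol j p.1 * dyadicSymbol k p.2 * Λ p.1 p.2 (fourierFn F p.1) (fourierFn G p.2) (fourierFn H (-p.1 - p.2)) := by
    intro p
    rw [Finset.sum_mul_sum, Finset.sum_mul]
    refine Finset.sum_congr rfl fun j _ => ?_
    rw [Finset.sum_mul]
  calc ∑ j ∈ Finset.Icc (-(N : ℤ)) N, ∑ k ∈ Finset.Icc (-(N : ℤ)) N,
        ∫ p : EuclideanSpace ℝ (Fin 3) × EuclideanSpace ℝ (Fin 3), dyadicSymbol j p.1 * dyadicSymbol k p.2 * Λ p.1 p.2 (fourierFn F p.1) (fourierFn G p.2) (fourierFn H (-p.1 - p.2))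
      = ∑ j ∈ Finset.Icc (-(N : ℤ)) N, ∫ p : EuclideanSpace ℝ (Fin 3) × EuclideanSpace ℝ (Fin 3), ∑ k ∈ Finset.Icc (-(N : ℤ)) N,
          dyadicSymbol j p.1 * dyadicSymbol k p.2 * Λ p.1 p.2 (fourierFn F p.1) (fourierFn G p.2) (fourierFn H (-p.1 - p.2)) :=
        Finset.sum_congr rfl fun j _ => (integral_finsetSum _ fun k _ => hI j k).symm
    _ = ∫ p : EuclideanSpace ℝ (Fin 3) × EuclideanSpace ℝ (Fin 3), ∑ j ∈ Finset.Icc (-(N : ℤ)) N, ∑ k ∈ Finset.Icc (-(N : ℤ)) N,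
          dyadicSymbol j p.1 * dyadicSymbol k p.2 * Λ p.1 p.2 (fourierFn F p.1) (fourierFn G p.2) (fourierFn H (-p.1 - p.2)) :=
        (integral_finsetSum _ fun j _ => integrable_finsetSum _ fun k _ => hI j k).symm
    _ = _ := integral_congr_ae (ae_of_all _ fun p => (hpt p).symm)

/-! ### Dominated convergence -/

/-- **The partial sums converge to the Euler form**:
`∑_{|j|,|k| ≤ N} ⟨B(P_jF, P_kG), H⟩ → ⟨B(F,G), H⟩` for `F, G ∈ H¹⁰`, `H ∈ L²` (dominated convergence
for the absolutely integrable integrand of (1.3); `s_N → 1` off the null set `ξ₁ξ₂ = 0`). -/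
theorem tendsto_sum_sum_eulerForm_pieces {F G : L2C} (H : L2C) (hF10 : eFourierSobolevNorm 10 F < ⊤)
    (hG10 : eFourierSobolevNorm 10 G < ⊤) :
    Tendsto (fun N : ℕ => ∑ j ∈ Finset.Icc (-(N : ℤ)) N, ∑ k ∈ Finset.Icc (-(N : ℤ)) N,
        eulerForm (fourierMultiplier ((memLp_top_dyadicSymbol (E := EuclideanSpace ℝ (Fin 3)) j).toLp _) F)
          (fourierMultiplier ((memLp_top_dyadicSymbol (E := EuclideanSpace ℝ (Fin 3)) k).toLp _) G) H)
      atTop (𝓝 (eulerForm F G H)) := by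
  have hΦ := integrable_Λ_fourierFn H hF10 hG10
  -- dominated convergence for the weighted integrals
  have hlim : Tendsto (fun N : ℕ => ∫ p : EuclideanSpace ℝ (Fin 3) × EuclideanSpace ℝ (Fin 3),
      (∑ j ∈ Finset.Icc (-(N : ℤ)) N, dyadicSymbol j p.1) * (∑ k ∈ Finset.Icc (-(N : ℤ)) N, dyadicSymbol k p.2) * Λ p.1 p.2 (fourierFn F p.1) (fourierFn G p.2) (fourierFn H (-p.1 - p.2))) atTop (𝓝 (∫ p : EuclideanSpace ℝ (Fin 3) × EuclideanSpace ℝ (Fin 3), Λ p.1 p.2 (fourierFn F p.1) (fourierFn G p.2) (fourierFn H (-p.1 - p.2)))) := by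
    refine tendsto_integral_of_dominated_convergence
      (fun p : EuclideanSpace ℝ (Fin 3) × EuclideanSpace ℝ (Fin 3) => 16 * ‖Λ p.1 p.2 (fourierFn F p.1) (fourierFn G p.2) (fourierFn H (-p.1 - p.2))‖) (fun N => ?_) (hΦ.norm.const_mul 16) (fun N => ae_of_all _ fun p => ?_) ?_
    · exact (((continuous_sum_Icc_dyadicSymbol N).comp continuous_fst).mul
        ((continuous_sum_Icc_dyadicSymbol N).comp continuous_snd)).aestronglyMeasurable.mul hΦ.1
    · rw [norm_mul, norm_mul, show (16 : ℝ) = 4 * 4 by norm_num]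
      gcongr
      · exact norm_sum_Icc_dyadicSymbol_le N p.1
      · exact norm_sum_Icc_dyadicSymbol_le N p.2
    · have h0 : ∀ᵐ ξ ∂(volume : Measure (EuclideanSpace ℝ (Fin 3))), ξ ≠ 0 :=
        compl_mem_ae_iff.mpr (measure_singleton _)
      have h1 : ∀ᵐ p : EuclideanSpace ℝ (Fin 3) × EuclideanSpace ℝ (Fin 3), p.1 ≠ 0 := by
        rw [Measure.volume_eq_prod]
        exact (Measure.quasiMeasurePreserving_fst (μ := (volume : Measure (EuclideanSpace ℝ (Fin 3))))
          (ν := (volume : Measure (EuclideanSpace ℝ (Fin 3))))).ae h0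
      have h2 : ∀ᵐ p : EuclideanSpace ℝ (Fin 3) × EuclideanSpace ℝ (Fin 3), p.2 ≠ 0 := by
        rw [Measure.volume_eq_prod]
        exact (Measure.quasiMeasurePreserving_snd (μ := (volume : Measure (EuclideanSpace ℝ (Fin 3))))
          (ν := (volume : Measure (EuclideanSpace ℝ (Fin 3))))).ae h0
      filter_upwards [h1, h2] with p hp1 hp2
      have := ((tendsto_sum_Icc_dyadicSymbol hp1).mul (tendsto_sum_Icc_dyadicSymbol hp2)).mul
        (tendsto_const_nhds (x := Λ p.1 p.2 (fourierFn F p.1) (fourierFn G p.2) (fourierFn H (-p.1 - p.2))))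
      simpa using this
  have hlim' := hlim.const_mul (-(↑π * I))
  have heq : eulerForm F G H = -(↑π * I) * ∫ p : EuclideanSpace ℝ (Fin 3) × EuclideanSpace ℝ (Fin 3),
      Λ p.1 p.2 (fourierFn F p.1) (fourierFn G p.2) (fourierFn H (-p.1 - p.2)) := rfl
  rw [heq]
  exact hlim'.congr fun N => (sum_sum_eulerForm_pieces_eq H hF10 hG10 N).symm

/-! ### The tame trilinear estimate -/

/-- **The tame paraproduct estimate for Tao's Euler form.** For divergence-free
`F, G ∈ L²(ℝ³; ℂ³)` of finite `H¹⁰` norm and every `H ∈ L²(ℝ³; ℂ³)`,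
`|⟨B(F,G), H⟩| ≤ K (‖F‖_{Ḃ⁰_{∞,1}} ‖G‖_{H¹⁰} + ‖F‖_{H¹⁰} ‖G‖_{Ḃ⁰_{∞,1}}) ‖H‖_{H⁻⁹}` with the
universal constant `K = 72π (2⁴⁰ √3 √11 + 5 · 2⁸⁰)` (Bony decomposition of `F ⊗ G`, the
`L^∞ × L² × L²` bound of part I on each pair of pieces, almost orthogonality, dominated
convergence). -/
theorem enorm_eulerForm_le_tame {F G : L2C} (H : L2C) (hF : IsFourierDivFree F) (hG : IsFourierDivFree G)
    (hF10 : eFourierSobolevNorm 10 F < ⊤) (hG10 : eFourierSobolevNorm 10 G < ⊤) :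
    ‖eulerForm F G H‖ₑ ≤
      (ENNReal.ofReal (72 * π) * 2 ^ 40 * (3 : ℝ≥0∞) ^ (1 / 2 : ℝ) * (11 : ℝ≥0∞) ^ (1 / 2 : ℝ) +
          5 * (ENNReal.ofReal (72 * π) * 2 ^ 80)) *
        (eHomBesovNorm 0 ∞ 1 ((F : L2C) : 𝓢'(EuclideanSpace ℝ (Fin 3), EuclideanSpace ℂ (Fin 3))) * eFourierSobolevNorm 10 G +
          eFourierSobolevNorm 10 F * eHomBesovNorm 0 ∞ 1 ((G : L2C) : 𝓢'(EuclideanSpace ℝ (Fin 3), EuclideanSpace ℂ (Fin 3)))) *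
        eFourierSobolevNorm (-9) H := by
  have hbd : ∀ N : ℕ, ‖∑ j ∈ Finset.Icc (-(N : ℤ)) N, ∑ k ∈ Finset.Icc (-(N : ℤ)) N,
      eulerForm (fourierMultiplier ((memLp_top_dyadicSymbol (E := EuclideanSpace ℝ (Fin 3)) j).toLp _) F)
        (fourierMultiplier ((memLp_top_dyadicSymbol (E := EuclideanSpace ℝ (Fin 3)) k).toLp _) G) H‖ₑ ≤
      (ENNReal.ofReal (72 * π) * 2 ^ 40 * (3 : ℝ≥0∞) ^ (1 / 2 : ℝ) * (11 : ℝ≥0∞) ^ (1 / 2 : ℝ) +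
          5 * (ENNReal.ofReal (72 * π) * 2 ^ 80)) *
        (eHomBesovNorm 0 ∞ 1 ((F : L2C) : 𝓢'(EuclideanSpace ℝ (Fin 3), EuclideanSpace ℂ (Fin 3))) * eFourierSobolevNorm 10 G +
          eFourierSobolevNorm 10 F * eHomBesovNorm 0 ∞ 1 ((G : L2C) : 𝓢'(EuclideanSpace ℝ (Fin 3), EuclideanSpace ℂ (Fin 3)))) *
        eFourierSobolevNorm (-9) H := by
    intro N
    refine (enorm_sum_le _ _).trans ((Finset.sum_le_sum fun j _ => enorm_sum_le _ _).trans ?_)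
    refine le_trans ?_ (tsum_tsum_enorm_pieces_le H hF hG)
    refine (Finset.sum_le_sum fun j _ => ENNReal.sum_le_tsum _).trans (ENNReal.sum_le_tsum _)
  exact (isClosed_le continuous_enorm continuous_const).mem_of_tendsto
    (tendsto_sum_sum_eulerForm_pieces H hF10 hG10) (Eventually.of_forall hbd)


/-- **The tame paraproduct estimate, with an abstract constant**: there is `K < ∞` with
`|⟨B(F,G), H⟩| ≤ K (‖F‖_{Ḃ⁰_{∞,1}} ‖G‖_{H¹⁰} + ‖F‖_{H¹⁰} ‖G‖_{Ḃ⁰_{∞,1}}) ‖H‖_{H⁻⁹}` for all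
divergence-free `F, G ∈ H¹⁰` and `H ∈ L²(ℝ³; ℂ³)`. -/
theorem exists_enorm_eulerForm_le_tame :
    ∃ K : ℝ≥0∞, K ≠ ⊤ ∧ ∀ (F G H : L2C), IsFourierDivFree F → IsFourierDivFree G →
      eFourierSobolevNorm 10 F < ⊤ → eFourierSobolevNorm 10 G < ⊤ →
      ‖eulerForm F G H‖ₑ ≤ K *
        (eHomBesovNorm 0 ∞ 1 ((F : L2C) : 𝓢'(EuclideanSpace ℝ (Fin 3), EuclideanSpace ℂ (Fin 3))) * eFourierSobolevNorm 10 G +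
          eFourierSobolevNorm 10 F * eHomBesovNorm 0 ∞ 1 ((G : L2C) : 𝓢'(EuclideanSpace ℝ (Fin 3), EuclideanSpace ℂ (Fin 3)))) *
        eFourierSobolevNorm (-9) H := by
  refine ⟨ENNReal.ofReal (72 * π) * 2 ^ 40 * (3 : ℝ≥0∞) ^ (1 / 2 : ℝ) * (11 : ℝ≥0∞) ^ (1 / 2 : ℝ) +
      5 * (ENNReal.ofReal (72 * π) * 2 ^ 80), ?_, fun F G H hF hG hF10 hG10 =>
    enorm_eulerForm_le_tame H hF hG hF10 hG10⟩
  refine ENNReal.add_ne_top.2 ⟨?_, ?_⟩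
  · exact ENNReal.mul_ne_top (ENNReal.mul_ne_top (ENNReal.mul_ne_top ENNReal.ofReal_ne_top (by simp))
      (ENNReal.rpow_ne_top_of_nonneg (by norm_num) (by simp)))
      (ENNReal.rpow_ne_top_of_nonneg (by norm_num) (by simp))
  · exact ENNReal.mul_ne_top (by simp) (ENNReal.mul_ne_top ENNReal.ofReal_ne_top (by simp))

end Summit.NavierStokesRegularity.NavierStokesRegularity.Theorems.PerpetualPumpThesis.FB

namespace Summit.NavierStokesRegularity.NavierStokesRegularity.Theorems.PerpetualPumpThesis

open MeasureTheory
open Literature.Analysis.FluidPDE Literature.Analysis.FluidPDE.Tao2016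
open Literature.Analysis.FunctionSpaces

/-- **Part Paraproduct of stub `tameDuhamelBound` (registered sub-goal `stub_FB_Paraproduct`)**: the
**tame paraproduct (Moser / Kato–Ponce type) estimate for Tao's Euler trilinear form** — there is
`K < ∞` such that for all divergence-free `F, G ∈ L²(ℝ³; ℂ³)` of finite `H¹⁰` norm and all
`H ∈ L²`, `|⟨B(F,G), H⟩| ≤ K (‖F‖_{Ḃ⁰_{∞,1}} ‖G‖_{H¹⁰} + ‖F‖_{H¹⁰} ‖G‖_{Ḃ⁰_{∞,1}}) ‖H‖_{H⁻⁹}`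
(Bony's decomposition into dyadic pieces, the physical-space `L^∞ × L² × L²` bound on each pair,
almost orthogonality, dominated convergence). -/
theorem stub_FB_Paraproduct : ∃ K : ENNReal, K ≠ ⊤ ∧ ∀ (F G H : L2C), IsFourierDivFree F → IsFourierDivFree G → eFourierSobolevNorm 10 F < ⊤ → eFourierSobolevNorm 10 G < ⊤ → ‖eulerForm F G H‖ₑ ≤ K * (eHomBesovNorm 0 ⊤ 1 ((F : L2C) : 𝓢'(EuclideanSpace ℝ (Fin 3), EuclideanSpace ℂ (Fin 3))) * eFourierSobolevNorm 10 G + eFourierSobolevNorm 10 F * eHomBesovNorm 0 ⊤ 1 ((G : L2C) : 𝓢'(EuclideanSpace ℝ (Fin 3), EuclideanSpace ℂ (Fin 3)))) * eFourierSobolevNorm (-9) H :=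
  FB.exists_enorm_eulerForm_le_tame

end Summit.NavierStokesRegularity.NavierStokesRegularity.Theorems.PerpetualPumpThesis
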